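import Summits.Ventures.Crystal3D.Theorems.StickyWulffConstantNoReconstructionGainSingleFamily
import Summits.Ventures.Crystal3D.Theorems.StickyWulffConstantNoReconstructionGainSlabFormLevel
import HarnessLib

/-!
# Single-family Barlow films: the tie circles (every unit normal, no exception)

HONEST FRAMING. Part of the venture `Summits/Ventures/Crystal3D` (cell `crystal3d-full`), helper
`--supports` the crux `NoReconstructionGain` (stmt-Ventures-19144, route
`route-Ventures-StickyWulffConstant`), line `adhesion`; removes the last hypothesis on the normal from
`…SingleFamily`.

On the three tie circles `√(2/3) ν₃ + ⟪τ, ν⟫ = 0` one registry-up slot is exactly `ν`-level and the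
regime certificates (strict inequalities) do not apply verbatim.  But their LOCAL form
(`nTilt_main`, `oneOverhang_main`, `twoOverhang_main`) concludes the `ν`-free inequality
`#cross(P, X' \ P) ≤ D(X' \ P)` and uses `ν` only through finitely many STRICT inequalities
(`⟪p, ν⟫ < ⟪q, ν⟫` on the finite configuration, the regime signs) plus the closure of the substrate
under the `ν`-downward registry directions.  So at a tie normal we run the certificate with the
perturbed grading `ν ± t e₃` (`t → 0⁺`; `−` when `ν₃ > 0`, `+` when `ν₃ = 0`): the strict inequalities
persist, the tie slot acquires a sign, the regime becomes `C ∈ {1, 2}` (no unit norm needed), and the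
closure directions it asks for are `ν`-downward or `ν`-LEVEL — supplied by the level-inclusive rim
reduction `slabForm_of_localClosure_level`.

* `clos_of_list_level`, `singleFamily_local` — bookkeeping (the seven sign patterns, closure split).
* `singleFamilyBarlowFilm_adhesion_all` (**rung**, registered by name): for EVERY unit `ν` with
  `ν₃ ≥ 0`, every `ρ ≥ 2`, every finite unit packing around the `ν`-slab sample (`R = 2`) whose film
  lies in `B = Λ₀ ∪ (Λ₀ ± w)` above the cut: `#cross ≤ contactDeficiency (X \ P) + 18432 ρ`.
* `singleFamilyBarlowFilm_adhesion_all_orbit` (**rung**): any family `g e₃` (`⟪ν, g e₃⟫ ≥ 0`), any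
  lattice isometry `g`; with `g = −1` every unit normal and every `{111}` family is covered.

WHAT THIS IS NOT: films mixing the four families; off-Barlow films; rung F-C1 not moved.
-/

noncomputable section

namespace Summit.Ventures.Crystal3D.Theorems

open Summit.Ventures.Crystal3D Finset Filter Topology
open Literature.MathematicalPhysics.StatisticalMechanics (barlowPos fccStacking barlowOffset layerNormal constHagg
  haggLabel_const barlowPos_apply_zero barlowPos_apply_one barlowPos_apply_two contactDeficiency)
open scoped InnerProductSpace

/-- Closure split, level-inclusive: from closure under the `ν`-nonpositive list directions, the
registry-up direction `N + τ` is available when `√(2/3)ν₃ + ⟪τ, ν⟫ ≤ 0` and the registry-down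
direction `−(N + τ)` when `≥ 0`. -/
theorem clos_of_list_level (ν : EuclideanSpace ℝ (Fin 3)) (X P : Finset (EuclideanSpace ℝ (Fin 3)))
    (hclos : ∀ p ∈ P, ∀ q ∈ X \ P, dist p q = 1 →
      ∀ d ∈ ([barlowPos 1 (Real.sqrt (2 / 3)) constHagg 0 1 0, -barlowPos 1 (Real.sqrt (2 / 3)) constHagg 0 1 0,
            barlowPos 1 (Real.sqrt (2 / 3)) constHagg 0 0 1, -barlowPos 1 (Real.sqrt (2 / 3)) constHagg 0 0 1,
            barlowPos 1 (Real.sqrt (2 / 3)) constHagg 0 1 (-1), -barlowPos 1 (Real.sqrt (2 / 3)) constHagg 0 1 (-1),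
            barlowPos 1 (Real.sqrt (2 / 3)) constHagg 1 0 0, -barlowPos 1 (Real.sqrt (2 / 3)) constHagg 1 0 0,
            barlowPos 1 (Real.sqrt (2 / 3)) constHagg (-1) 1 0, -barlowPos 1 (Real.sqrt (2 / 3)) constHagg (-1) 1 0,
            barlowPos 1 (Real.sqrt (2 / 3)) constHagg (-1) 0 1, -barlowPos 1 (Real.sqrt (2 / 3)) constHagg (-1) 0 1] :
            List (EuclideanSpace ℝ (Fin 3))),
        ⟪d, ν⟫_ℝ ≤ 0 → p + d ∈ P) :
    ∀ τ ∈ ([barlowOffset 1, barlowOffset 1 - barlowPos 1 (Real.sqrt (2 / 3)) constHagg 0 1 0,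
          barlowOffset 1 - barlowPos 1 (Real.sqrt (2 / 3)) constHagg 0 0 1] : List (EuclideanSpace ℝ (Fin 3))),
      (Real.sqrt (2 / 3) * ν 2 + ⟪τ, ν⟫_ℝ ≤ 0 →
        ∀ p ∈ P, ∀ q ∈ X \ P, dist p q = 1 → p + (layerNormal (Real.sqrt (2 / 3)) + τ) ∈ P) ∧
      (0 ≤ Real.sqrt (2 / 3) * ν 2 + ⟪τ, ν⟫_ℝ →
        ∀ p ∈ P, ∀ q ∈ X \ P, dist p q = 1 → p - (layerNormal (Real.sqrt (2 / 3)) + τ) ∈ P) := by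
  intro τ hτ
  obtain ⟨e1, e2, e3, -, -, -⟩ := polar_vectors_eq
  have hN := inner_layerNormal_left ν
  simp only [List.mem_cons, List.mem_nil_iff, or_false] at hτ
  rcases hτ with rfl | rfl | rfl
  · refine ⟨fun hlt p hp q hq hd => ?_, fun hgt p hp q hq hd => ?_⟩
    · rw [← e1]
      exact hclos p hp q hq hd _ (by simp) (by rw [e1, inner_add_left, hN]; exact hlt)
    · rw [← e1, sub_eq_add_neg]
      exact hclos p hp q hq hd _ (by simp) (by rw [inner_neg_left, e1, inner_add_left, hN]; linarith)
  · refine ⟨fun hlt p hp q hq hd => ?_, fun hgt p hp q hq hd => ?_⟩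
    · rw [show layerNormal (Real.sqrt (2 / 3)) + (barlowOffset 1 - barlowPos 1 (Real.sqrt (2 / 3)) constHagg 0 1 0)
          = -barlowPos 1 (Real.sqrt (2 / 3)) constHagg (-1) 1 0 by rw [e2, neg_neg]]
      exact hclos p hp q hq hd _ (by simp)
        (by rw [inner_neg_left, e2, inner_neg_left, inner_add_left, hN]; linarith)
    · rw [show p - (layerNormal (Real.sqrt (2 / 3)) + (barlowOffset 1 - barlowPos 1 (Real.sqrt (2 / 3)) constHagg 0 1 0))
          = p + barlowPos 1 (Real.sqrt (2 / 3)) constHagg (-1) 1 0 by rw [e2]; abel]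
      exact hclos p hp q hq hd _ (by simp) (by rw [e2, inner_neg_left, inner_add_left, hN]; linarith)
  · refine ⟨fun hlt p hp q hq hd => ?_, fun hgt p hp q hq hd => ?_⟩
    · rw [show layerNormal (Real.sqrt (2 / 3)) + (barlowOffset 1 - barlowPos 1 (Real.sqrt (2 / 3)) constHagg 0 0 1)
          = -barlowPos 1 (Real.sqrt (2 / 3)) constHagg (-1) 0 1 by rw [e3, neg_neg]]
      exact hclos p hp q hq hd _ (by simp)
        (by rw [inner_neg_left, e3, inner_neg_left, inner_add_left, hN]; linarith)
    · rw [show p - (layerNormal (Real.sqrt (2 / 3)) + (barlowOffset 1 - barlowPos 1 (Real.sqrt (2 / 3)) constHagg 0 0 1))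
          = p + barlowPos 1 (Real.sqrt (2 / 3)) constHagg (-1) 0 1 by rw [e3]; abel]
      exact hclos p hp q hq hd _ (by simp) (by rw [e3, inner_neg_left, inner_add_left, hN]; linarith)

/-- **The local single-family certificate for a grading vector `ν`** (not necessarily a unit vector
unless all three registry-up slots are `ν`-upward): film in `B`, substrate `ν`-below the film, no
`ν`-level registry-up slot, `ν₃ ≥ 0`, and the closure each regime needs ⇒ `#cross ≤ D`. -/
theorem singleFamily_local (X P : Finset (EuclideanSpace ℝ (Fin 3)))
    (hX : ∀ p ∈ X, ∀ q ∈ X, p ≠ q → 1 ≤ dist p q) (hPX : P ⊆ X) (ν : EuclideanSpace ℝ (Fin 3))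
    (hunit : (∀ τ ∈ ([barlowOffset 1, barlowOffset 1 - barlowPos 1 (Real.sqrt (2 / 3)) constHagg 0 1 0,
          barlowOffset 1 - barlowPos 1 (Real.sqrt (2 / 3)) constHagg 0 0 1] : List (EuclideanSpace ℝ (Fin 3))),
        0 < Real.sqrt (2 / 3) * ν 2 + ⟪τ, ν⟫_ℝ) → ‖ν‖ = 1)
    (hPΛ : ∀ p ∈ P, p ∈ fccStacking 1 (Real.sqrt (2 / 3)))
    (hfilm : ∀ q ∈ X \ P, q ∈ fccStacking 1 (Real.sqrt (2 / 3)) ∨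
      q - barlowOffset 1 ∈ fccStacking 1 (Real.sqrt (2 / 3)) ∨
      q + barlowOffset 1 ∈ fccStacking 1 (Real.sqrt (2 / 3)))
    (hbelow : ∀ p ∈ P, ∀ q ∈ X \ P, ⟪p, ν⟫_ℝ < ⟪q, ν⟫_ℝ)
    (hs0 : 0 ≤ Real.sqrt (2 / 3) * ν 2)
    (hne : ∀ τ ∈ ([barlowOffset 1, barlowOffset 1 - barlowPos 1 (Real.sqrt (2 / 3)) constHagg 0 1 0,
          barlowOffset 1 - barlowPos 1 (Real.sqrt (2 / 3)) constHagg 0 0 1] : List (EuclideanSpace ℝ (Fin 3))),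
        Real.sqrt (2 / 3) * ν 2 + ⟪τ, ν⟫_ℝ ≠ 0)
    (hclosA : ∀ τ ∈ ([barlowOffset 1, barlowOffset 1 - barlowPos 1 (Real.sqrt (2 / 3)) constHagg 0 1 0,
          barlowOffset 1 - barlowPos 1 (Real.sqrt (2 / 3)) constHagg 0 0 1] : List (EuclideanSpace ℝ (Fin 3))),
        Real.sqrt (2 / 3) * ν 2 + ⟪τ, ν⟫_ℝ < 0 →
        ∀ p ∈ P, ∀ q ∈ X \ P, dist p q = 1 → p + (layerNormal (Real.sqrt (2 / 3)) + τ) ∈ P)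
    (hclosB : ∀ τ ∈ ([barlowOffset 1, barlowOffset 1 - barlowPos 1 (Real.sqrt (2 / 3)) constHagg 0 1 0,
          barlowOffset 1 - barlowPos 1 (Real.sqrt (2 / 3)) constHagg 0 0 1] : List (EuclideanSpace ℝ (Fin 3))),
        0 < Real.sqrt (2 / 3) * ν 2 + ⟪τ, ν⟫_ℝ →
        ∀ p ∈ P, ∀ q ∈ X \ P, dist p q = 1 → p - (layerNormal (Real.sqrt (2 / 3)) + τ) ∈ P) :
    ((((P ×ˢ (X \ P)).filter fun pq => dist pq.1 pq.2 = 1).card : ℕ) : ℝ) ≤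
      contactDeficiency (X \ P) := by
  classical
  have hsum : barlowOffset 1 + (barlowOffset 1 - barlowPos 1 (Real.sqrt (2 / 3)) constHagg 0 1 0) +
      (barlowOffset 1 - barlowPos 1 (Real.sqrt (2 / 3)) constHagg 0 0 1) = 0 := hollow_triple_sum
  have hβ : ⟪barlowOffset 1, ν⟫_ℝ + ⟪barlowOffset 1 - barlowPos 1 (Real.sqrt (2 / 3)) constHagg 0 1 0, ν⟫_ℝ +
      ⟪barlowOffset 1 - barlowPos 1 (Real.sqrt (2 / 3)) constHagg 0 0 1, ν⟫_ℝ = 0 := by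
    rw [← inner_add_left, ← inner_add_left, hsum, inner_zero_left]
  have n1 := hne (barlowOffset 1) (by simp)
  have n2 := hne (barlowOffset 1 - barlowPos 1 (Real.sqrt (2 / 3)) constHagg 0 1 0) (by simp)
  have n3 := hne (barlowOffset 1 - barlowPos 1 (Real.sqrt (2 / 3)) constHagg 0 0 1) (by simp)
  have hT : ∀ τ ∈ ([barlowOffset 1, barlowOffset 1 - barlowPos 1 (Real.sqrt (2 / 3)) constHagg 0 1 0,
          barlowOffset 1 - barlowPos 1 (Real.sqrt (2 / 3)) constHagg 0 0 1] : List (EuclideanSpace ℝ (Fin 3))), τ = barlowOffset 1 ∨ τ = barlowOffset 1 - barlowPos 1 (Real.sqrt (2 / 3)) constHagg 0 1 0 ∨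
      τ = barlowOffset 1 - barlowPos 1 (Real.sqrt (2 / 3)) constHagg 0 0 1 := fun τ hτ => by
    simpa using hτ
  rcases n1.lt_or_gt with a1 | a1 <;> rcases n2.lt_or_gt with a2 | a2 <;> rcases n3.lt_or_gt with a3 | a3
  · exfalso; linarith
  · exact twoOverhang_main X P hX hPX ν _ _ _ hPΛ hfilm hbelow
      (fun τ hτ => by simp only [List.mem_cons, List.mem_nil_iff, or_false] at hτ; tauto)
      (by simp) (by simp) (by simp) hsum hs0 a1 a2 a3 (hclosA _ (by simp) a1)
  · exact twoOverhang_main X P hX hPX ν _ _ _ hPΛ hfilm hbelow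
      (fun τ hτ => by simp only [List.mem_cons, List.mem_nil_iff, or_false] at hτ; tauto)
      (by simp) (by simp) (by simp) (by rw [← hsum]; abel) hs0 a1 a3 a2 (hclosA _ (by simp) a1)
  · exact oneOverhang_main X P hX hPX ν _ _ _ hPΛ hfilm hbelow
      (fun τ hτ => by simp only [List.mem_cons, List.mem_nil_iff, or_false] at hτ; tauto)
      (by simp) (by simp) (by simp) hsum hs0 a1 a2 a3
      (hclosA _ (by simp) a1) (hclosB _ (by simp) a2)
  · exact twoOverhang_main X P hX hPX ν _ _ _ hPΛ hfilm hbelow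
      (fun τ hτ => by simp only [List.mem_cons, List.mem_nil_iff, or_false] at hτ; tauto)
      (by simp) (by simp) (by simp) (by rw [← hsum]; abel) hs0 a2 a3 a1 (hclosA _ (by simp) a2)
  · exact oneOverhang_main X P hX hPX ν _ _ _ hPΛ hfilm hbelow
      (fun τ hτ => by simp only [List.mem_cons, List.mem_nil_iff, or_false] at hτ; tauto)
      (by simp) (by simp) (by simp) (by rw [← hsum]; abel) hs0 a2 a1 a3
      (hclosA _ (by simp) a2) (hclosB _ (by simp) a1)
  · exact oneOverhang_main X P hX hPX ν _ _ _ hPΛ hfilm hbelow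
      (fun τ hτ => by simp only [List.mem_cons, List.mem_nil_iff, or_false] at hτ; tauto)
      (by simp) (by simp) (by simp) (by rw [← hsum]; abel) hs0 a3 a1 a2
      (hclosA _ (by simp) a3) (hclosB _ (by simp) a1)
  · have hpos : ∀ τ ∈ ([barlowOffset 1, barlowOffset 1 - barlowPos 1 (Real.sqrt (2 / 3)) constHagg 0 1 0,
          barlowOffset 1 - barlowPos 1 (Real.sqrt (2 / 3)) constHagg 0 0 1] : List (EuclideanSpace ℝ (Fin 3))), 0 < Real.sqrt (2 / 3) * ν 2 + ⟪τ, ν⟫_ℝ := by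
      intro τ hτ
      rcases hT τ hτ with rfl | rfl | rfl
      exacts [a1, a2, a3]
    refine nTilt_main X P hX hPX ν (hunit hpos) hPΛ hfilm hbelow hpos fun p hp q hq hd τ hτ => ?_
    rw [show p - layerNormal (Real.sqrt (2 / 3)) - τ = p - (layerNormal (Real.sqrt (2 / 3)) + τ) by abel]
    exact hclosB τ hτ (hpos τ hτ) p hp q hq hd

/-- **Every single-family (basal) Barlow film above the cut satisfies the atom, for EVERY unit
normal with `ν₃ ≥ 0`** — tie circles included (`R = 2`, `C = 18432`; registered by name). -/
theorem singleFamilyBarlowFilm_adhesion_all :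
    ∃ R C : ℝ, 1 ≤ R ∧ ∀ ν : EuclideanSpace ℝ (Fin 3), ‖ν‖ = 1 → ∀ ρ : ℝ, R ≤ ρ →
      ∀ X P : Finset (EuclideanSpace ℝ (Fin 3)),
      (∀ p ∈ X, ∀ q ∈ X, p ≠ q → 1 ≤ dist p q) → P ⊆ X →
      (∀ p, p ∈ P ↔ (p ∈ fccStacking 1 (Real.sqrt (2 / 3)) ∧ -(2 * R) ≤ ⟪p, ν⟫_ℝ ∧
        ⟪p, ν⟫_ℝ ≤ -R ∧ ‖p‖ ^ 2 - ⟪p, ν⟫_ℝ ^ 2 ≤ ρ ^ 2)) →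
      0 ≤ ν 2 →
      (∀ q ∈ X \ P, q ∈ fccStacking 1 (Real.sqrt (2 / 3)) ∨
        q - barlowOffset 1 ∈ fccStacking 1 (Real.sqrt (2 / 3)) ∨
        q + barlowOffset 1 ∈ fccStacking 1 (Real.sqrt (2 / 3))) →
      (∀ q ∈ X \ P, -R < ⟪q, ν⟫_ℝ) →
      ((((P ×ˢ (X \ P)).filter fun pq => dist pq.1 pq.2 = 1).card : ℕ) : ℝ) ≤
        contactDeficiency (X \ P) + C * ρ := by
  classical
  refine ⟨2, 18432, by norm_num, fun ν hν ρ hρ X P hX hPX hP hν2 hfilm habove => ?_⟩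
  refine slabForm_of_localClosure_level ν hν ρ hρ X P hX hPX hP habove fun X' hPX' hX'X hclos' => ?_
  have hX' : ∀ p ∈ X', ∀ q ∈ X', p ≠ q → 1 ≤ dist p q := fun p hp q hq => hX p (hX'X hp) q (hX'X hq)
  have hPΛ : ∀ p ∈ P, p ∈ fccStacking 1 (Real.sqrt (2 / 3)) := fun p hp => ((hP p).1 hp).1
  have hfilm' : ∀ q ∈ X' \ P, q ∈ fccStacking 1 (Real.sqrt (2 / 3)) ∨
      q - barlowOffset 1 ∈ fccStacking 1 (Real.sqrt (2 / 3)) ∨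
      q + barlowOffset 1 ∈ fccStacking 1 (Real.sqrt (2 / 3)) := fun q hq =>
    hfilm q (mem_sdiff.2 ⟨hX'X (mem_sdiff.1 hq).1, (mem_sdiff.1 hq).2⟩)
  have hbelow : ∀ p ∈ P, ∀ q ∈ X' \ P, ⟪p, ν⟫_ℝ < ⟪q, ν⟫_ℝ := fun p hp q hq => by
    obtain ⟨-, -, h2, -⟩ := (hP p).1 hp
    linarith [habove q (mem_sdiff.2 ⟨hX'X (mem_sdiff.1 hq).1, (mem_sdiff.1 hq).2⟩)]
  have closL := clos_of_list_level ν X' P hclos'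
  set Tl : List (EuclideanSpace ℝ (Fin 3)) := ([barlowOffset 1, barlowOffset 1 - barlowPos 1 (Real.sqrt (2 / 3)) constHagg 0 1 0,
          barlowOffset 1 - barlowPos 1 (Real.sqrt (2 / 3)) constHagg 0 0 1] : List (EuclideanSpace ℝ (Fin 3))) with hTl
  -- the generic case: no tie
  by_cases htie : ∀ τ ∈ Tl, Real.sqrt (2 / 3) * ν 2 + ⟪τ, ν⟫_ℝ ≠ 0
  · exact singleFamily_local X' P hX' hPX' ν (fun _ => hν) hPΛ hfilm' hbelow
      (mul_nonneg (Real.sqrt_nonneg _) hν2) htie (fun τ hτ h => (closL τ hτ).1 h.le)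
      (fun τ hτ h => (closL τ hτ).2 h.le)
  push Not at htie
  obtain ⟨τ₀, hτ₀, hτ₀0⟩ := htie
  -- a tie: perturb the grading to `ν + (t δ) • e₃`, `t → 0⁺`
  set e₃ : EuclideanSpace ℝ (Fin 3) := EuclideanSpace.single (2 : Fin 3) (1 : ℝ) with he₃
  set δ : ℝ := if ν 2 = 0 then 1 else -1 with hδ
  set νt : ℝ → EuclideanSpace ℝ (Fin 3) := fun t => ν + (t * δ) • e₃ with hνt
  have hinner : ∀ (x : EuclideanSpace ℝ (Fin 3)) (t : ℝ), ⟪x, νt t⟫_ℝ = ⟪x, ν⟫_ℝ + t * δ * x 2 := by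
    intro x t
    rw [hνt]; dsimp only
    rw [inner_add_right, inner_smul_right, he₃, EuclideanSpace.inner_single_right]
    simp
  have h2t : ∀ t, νt t 2 = ν 2 + t * δ := by
    intro t; rw [hνt, he₃]; simp
  have hs : ∀ τ ∈ Tl, ∀ t, Real.sqrt (2 / 3) * νt t 2 + ⟪τ, νt t⟫_ℝ =
      (Real.sqrt (2 / 3) * ν 2 + ⟪τ, ν⟫_ℝ) + t * δ * Real.sqrt (2 / 3) := by
    intro τ hτ t
    rw [h2t, hinner, hollow_apply_two hτ]; ring
  have hcont : ∀ x : EuclideanSpace ℝ (Fin 3), Continuous fun t : ℝ => ⟪x, νt t⟫_ℝ := by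
    intro x
    simp only [hinner]
    fun_prop
  have h23 : 0 < Real.sqrt (2 / 3) := Real.sqrt_pos.2 (by norm_num)
  -- (E1) the substrate stays below the film
  have E1 : ∀ᶠ t in 𝓝[>] (0 : ℝ), ∀ pq ∈ P ×ˢ (X' \ P), ⟪pq.1, νt t⟫_ℝ < ⟪pq.2, νt t⟫_ℝ := by
    rw [Filter.eventually_all_finset]
    intro pq hpq
    obtain ⟨hp, hq⟩ := mem_product.1 hpq
    have h0 : 0 < ⟪pq.2 - pq.1, νt 0⟫_ℝ := by
      rw [inner_sub_left, hinner, hinner]; simp only [zero_mul, add_zero]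
      linarith [hbelow _ hp _ hq]
    have hev := ((hcont (pq.2 - pq.1)).tendsto 0).eventually_const_lt h0
    refine (hev.filter_mono nhdsWithin_le_nhds).mono fun t ht => ?_
    rw [inner_sub_left] at ht; linarith
  -- (E2) signs of the three registry quantities
  have E2 : ∀ᶠ t in 𝓝[>] (0 : ℝ), ∀ τ ∈ Tl.toFinset,
      Real.sqrt (2 / 3) * νt t 2 + ⟪τ, νt t⟫_ℝ ≠ 0 ∧
      (Real.sqrt (2 / 3) * νt t 2 + ⟪τ, νt t⟫_ℝ < 0 → Real.sqrt (2 / 3) * ν 2 + ⟪τ, ν⟫_ℝ ≤ 0) ∧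
      (0 < Real.sqrt (2 / 3) * νt t 2 + ⟪τ, νt t⟫_ℝ → 0 ≤ Real.sqrt (2 / 3) * ν 2 + ⟪τ, ν⟫_ℝ) := by
    rw [Filter.eventually_all_finset]
    intro τ hτ
    rw [List.mem_toFinset] at hτ
    have hδ0 : δ ≠ 0 := by rw [hδ]; split_ifs <;> norm_num
    rcases lt_trichotomy (Real.sqrt (2 / 3) * ν 2 + ⟪τ, ν⟫_ℝ) 0 with hlt | heq | hgt
    · -- stays negative
      have hc : Continuous fun t : ℝ => (Real.sqrt (2 / 3) * ν 2 + ⟪τ, ν⟫_ℝ) + t * δ * Real.sqrt (2 / 3) := by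
        fun_prop
      have hev := (hc.tendsto 0).eventually_lt_const (u := 0) (by simpa only [zero_mul, add_zero] using hlt)
      refine (hev.filter_mono nhdsWithin_le_nhds).mono fun t ht => ?_
      rw [hs τ hτ]
      exact ⟨ht.ne, fun _ => hlt.le, fun h => absurd h (not_lt.2 ht.le)⟩
    · -- the tie: sign of `δ`
      refine eventually_nhdsWithin_of_forall fun t (ht : 0 < t) => ?_
      rw [hs τ hτ, heq, zero_add]
      refine ⟨mul_ne_zero (mul_ne_zero ht.ne' hδ0) h23.ne', fun _ => le_rfl, fun _ => le_rfl⟩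
    · have hc : Continuous fun t : ℝ => (Real.sqrt (2 / 3) * ν 2 + ⟪τ, ν⟫_ℝ) + t * δ * Real.sqrt (2 / 3) := by
        fun_prop
      have hev := (hc.tendsto 0).eventually_const_lt (u := 0) (by simpa only [zero_mul, add_zero] using hgt)
      refine (hev.filter_mono nhdsWithin_le_nhds).mono fun t ht => ?_
      rw [hs τ hτ]
      exact ⟨ht.ne', fun h => absurd h (not_lt.2 ht.le), fun _ => hgt.le⟩
  -- (E3) third coordinate stays nonnegative; (E4) the tie slot gets the sign of `δ`
  have E3 : ∀ᶠ t in 𝓝[>] (0 : ℝ), 0 ≤ νt t 2 ∧ 0 < t := by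
    by_cases hz : ν 2 = 0
    · refine eventually_nhdsWithin_of_forall fun t (ht : 0 < t) => ⟨?_, ht⟩
      rw [h2t, hz, hδ, if_pos hz]; linarith
    · have hpos : 0 < ν 2 := lt_of_le_of_ne hν2 (Ne.symm hz)
      have hev : ∀ᶠ t in 𝓝 (0 : ℝ), t < ν 2 := eventually_lt_nhds hpos
      refine (hev.filter_mono nhdsWithin_le_nhds).mp (eventually_nhdsWithin_of_forall fun t (ht : 0 < t) hlt => ⟨?_, ht⟩)
      rw [h2t, hδ, if_neg hz]; linarith
  obtain ⟨t, hE1, hE2, hE3, ht⟩ := (E1.and (E2.and E3)).exists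
  have hE2' : ∀ τ ∈ Tl, _ := fun τ hτ => hE2 τ (List.mem_toFinset.2 hτ)
  -- not all three registry slots are `νt`-upward (so no unit norm is needed)
  have hnotC0 : ¬ ∀ τ ∈ Tl, 0 < Real.sqrt (2 / 3) * νt t 2 + ⟪τ, νt t⟫_ℝ := by
    intro hall
    by_cases hz : ν 2 = 0
    · -- `ν₃ = 0`: some registry quantity is negative at `ν`, and stays so
      have hβ : (Real.sqrt (2 / 3) * ν 2 + ⟪barlowOffset 1, ν⟫_ℝ) +
          (Real.sqrt (2 / 3) * ν 2 + ⟪barlowOffset 1 - barlowPos 1 (Real.sqrt (2 / 3)) constHagg 0 1 0, ν⟫_ℝ) +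
          (Real.sqrt (2 / 3) * ν 2 + ⟪barlowOffset 1 - barlowPos 1 (Real.sqrt (2 / 3)) constHagg 0 0 1, ν⟫_ℝ) = 0 := by
        rw [hz, mul_zero, zero_add, zero_add, zero_add, ← inner_add_left, ← inner_add_left, hollow_triple_sum,
          inner_zero_left]
      have m1 : barlowOffset 1 ∈ Tl := by simp [hTl]
      have m2 : barlowOffset 1 - barlowPos 1 (Real.sqrt (2 / 3)) constHagg 0 1 0 ∈ Tl := by simp [hTl]
      have m3 : barlowOffset 1 - barlowPos 1 (Real.sqrt (2 / 3)) constHagg 0 0 1 ∈ Tl := by simp [hTl]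
      have g1 := (hE2' _ m1).2.2 (hall _ m1)
      have g2 := (hE2' _ m2).2.2 (hall _ m2)
      have g3 := (hE2' _ m3).2.2 (hall _ m3)
      have z1 : Real.sqrt (2 / 3) * ν 2 + ⟪barlowOffset 1, ν⟫_ℝ = 0 := by linarith
      have z2 : Real.sqrt (2 / 3) * ν 2 + ⟪barlowOffset 1 - barlowPos 1 (Real.sqrt (2 / 3)) constHagg 0 1 0, ν⟫_ℝ = 0 := by
        linarith
      have z3 : Real.sqrt (2 / 3) * ν 2 + ⟪barlowOffset 1 - barlowPos 1 (Real.sqrt (2 / 3)) constHagg 0 0 1, ν⟫_ℝ = 0 := by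
        linarith
      have hu : ⟪barlowPos 1 (Real.sqrt (2 / 3)) constHagg 0 1 0, ν⟫_ℝ = ν 0 := by
        rw [EuclideanSpace.inner_eq_star_dotProduct]
        simp only [star_trivial, dotProduct, Fin.sum_univ_three]
        simp [barlowPos_apply_zero, barlowPos_apply_one, barlowPos_apply_two]
      have hv : ⟪barlowPos 1 (Real.sqrt (2 / 3)) constHagg 0 0 1, ν⟫_ℝ = ν 0 / 2 + Real.sqrt 3 / 2 * ν 1 := by
        rw [EuclideanSpace.inner_eq_star_dotProduct]
        simp only [star_trivial, dotProduct, Fin.sum_univ_three]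
        simp [barlowPos_apply_zero, barlowPos_apply_one, barlowPos_apply_two]
        ring
      have h0 : ν 0 = 0 := by rw [← hu]; rw [inner_sub_left] at z2; linarith
      have h1 : ν 1 = 0 := by
        rw [inner_sub_left, hv, h0] at z3
        have h3 : 0 < Real.sqrt 3 := Real.sqrt_pos.2 (by norm_num)
        nlinarith
      have : ‖ν‖ ^ 2 = 0 := by
        rw [EuclideanSpace.real_norm_sq_eq, Fin.sum_univ_three, h0, h1, hz]; norm_num
      rw [hν] at this; norm_num at this
    · have := hall τ₀ hτ₀
      rw [hs τ₀ hτ₀, hτ₀0, zero_add, hδ, if_neg hz] at this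
      nlinarith
  refine singleFamily_local X' P hX' hPX' (νt t) (fun hall => absurd hall hnotC0) hPΛ hfilm'
    (fun p hp q hq => hE1 (p, q) (mem_product.2 ⟨hp, hq⟩)) (mul_nonneg h23.le hE3)
    (fun τ hτ => (hE2' τ hτ).1) (fun τ hτ h => (closL τ hτ).1 ((hE2' τ hτ).2.1 h))
    (fun τ hτ h => (closL τ hτ).2 ((hE2' τ hτ).2.2 h))

/-- **The same for the `{111}` family `g e₃` of any lattice isometry `g`, every unit normal with
`⟪ν, g e₃⟫ ≥ 0`** (registered by name); `g = −1` covers `⟪ν, e₃⟫ ≤ 0`, so every unit normal and every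
family is covered. -/
theorem singleFamilyBarlowFilm_adhesion_all_orbit :
    ∃ R C : ℝ, 1 ≤ R ∧ ∀ ν : EuclideanSpace ℝ (Fin 3), ‖ν‖ = 1 → ∀ ρ : ℝ, R ≤ ρ →
      ∀ X P : Finset (EuclideanSpace ℝ (Fin 3)),
      (∀ p ∈ X, ∀ q ∈ X, p ≠ q → 1 ≤ dist p q) → P ⊆ X →
      (∀ p, p ∈ P ↔ (p ∈ fccStacking 1 (Real.sqrt (2 / 3)) ∧ -(2 * R) ≤ ⟪p, ν⟫_ℝ ∧
        ⟪p, ν⟫_ℝ ≤ -R ∧ ‖p‖ ^ 2 - ⟪p, ν⟫_ℝ ^ 2 ≤ ρ ^ 2)) →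
      ∀ g : EuclideanSpace ℝ (Fin 3) ≃ₗᵢ[ℝ] EuclideanSpace ℝ (Fin 3),
      (∀ p ∈ fccStacking 1 (Real.sqrt (2 / 3)), g p ∈ fccStacking 1 (Real.sqrt (2 / 3))) →
      (∀ p ∈ fccStacking 1 (Real.sqrt (2 / 3)), g.symm p ∈ fccStacking 1 (Real.sqrt (2 / 3))) →
      0 ≤ ⟪ν, g (EuclideanSpace.single (2 : Fin 3) (1 : ℝ))⟫_ℝ →
      (∀ q ∈ X \ P, q ∈ fccStacking 1 (Real.sqrt (2 / 3)) ∨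
        q - g (barlowOffset 1) ∈ fccStacking 1 (Real.sqrt (2 / 3)) ∨
        q + g (barlowOffset 1) ∈ fccStacking 1 (Real.sqrt (2 / 3))) →
      (∀ q ∈ X \ P, -R < ⟪q, ν⟫_ℝ) →
      ((((P ×ˢ (X \ P)).filter fun pq => dist pq.1 pq.2 = 1).card : ℕ) : ℝ) ≤
        contactDeficiency (X \ P) + C * ρ := by
  classical
  have hT := slabRung_transport (fun ν => 0 ≤ ν 2) (by
      obtain ⟨R, C, hR, h⟩ := singleFamilyBarlowFilm_adhesion_all
      exact ⟨R, C, hR, fun ν hν ρ hρ X P hX hPX hP hreg hfilm habove =>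
        h ν hν ρ hρ X P hX hPX hP hreg hfilm habove⟩)
  obtain ⟨R, C, hR, h⟩ := hT
  refine ⟨R, C, hR, fun ν hν ρ hρ X P hX hPX hP g hg hg' h0 => h ν hν ρ hρ X P hX hPX hP g hg hg' ?_⟩
  have e2 : (g.symm ν) 2 = ⟪ν, g (EuclideanSpace.single (2 : Fin 3) (1 : ℝ))⟫_ℝ := by
    have : ⟪g.symm ν, EuclideanSpace.single (2 : Fin 3) (1 : ℝ)⟫_ℝ = (g.symm ν) 2 := by
      simp [EuclideanSpace.inner_single_right]
    rw [← this, ← g.inner_map_map, LinearIsometryEquiv.apply_symm_apply]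
  show 0 ≤ (g.symm ν) 2
  rw [e2]; exact h0

end Summit.Ventures.Crystal3D.Theorems

end
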